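import Mathlib
import HarnessLib
import Summits.ValiantsHypothesis.ValiantsHypothesis.Theorems.LacunarySymmetroidMatrixDescartesProductPlusOneUnswitchedWindow

/-!
# ValiantsHypothesis / LacunarySymmetroid — crux `MatrixDescartes` (stmt-ValiantsHypothesis-18050, V1),
# LINE (A) «product_plus_one», floor `OneChangeFloorK3`: the SWITCHED-WINDOW LAW (top weight, every support ratio)

Companion of ✓ `…ProductPlusOneUnswitchedWindow` (bottom weight `x^{−p}`: rows OPPOSITE THEIR TOP LETTER are monotone).  Here the
TOP weight `x^{−q}`: for a factor `g = a + b x^p + c x^q` (`p = e+1`, `q = e+k+2`) put `T = Ψ_g / x^{q−p} = (p b + q c x^{q−p})/(x^{q−p}·g)`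
(`= x^{1−q}·g′/g`).  Its derivative has the Riccati form (no sign hypothesis, `top_numerator_eq`)

  `x^{q−p}·num − (q−p)·x^{q−p−1}·N·g = −x^{q−p−1}·((q−p)p·b·g(x) + x^p·N²)`,  `N = p b + q c x^{q−p}`,

so `T` is strictly decreasing at every `x > 0` where the factor sits ALONGSIDE ITS MIDDLE LETTER, `b·g(x) > 0` (`top_deriv_numerator_neg`):
a one-signed row `(+,+,+)` everywhere, a coherent no-dip row `(+,+,−)` BEFORE its zero, an incoherent no-dip row `(+,−,−)` AFTER its zero
(SWITCHED; the line's «riser»), a dip row `(+,−,+)` inside its dip — EVERY support ratio.  Consequences (bottom coupling, `K = 3`):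

* `hasDerivAt_top_neg_of_rows`, `top_injective_of_rows` — `Σ_j T_j` is strictly decreasing on a window where every row is alongside its
  middle letter (or has no middle letter: `b = 0`, `c ≠ 0`, `g ≠ 0`), hence injective (Rolle);
* ★ `euler_window_roots_le_one_of_middle` — on such a window `[u,v] ⊂ (0,∞)` the c-free Euler numerator `eulerNumerator d a 0` (unfolded)
  has AT MOST ONE root, ANY support `d 0 < d 1 < d 2`;
* `middle_aligned_of_le` — for an incoherent no-dip row «alongside its middle letter» (= switched) at `u` propagates to `[u, ∞)`;
  ★ `euler_roots_above_le_one_lateNoDip` — LATE LAW: in a company of no-dip and one-signed rows of ANY ratio, on a window `[u,v]` where every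
  incoherent row is already switched at `u` and every coherent row is still unswitched (alongside its middle letter) there is at most ONE
  critical point.

With the unswitched-window law this brackets the floor's open core at ratio `> 4` from both sides: a window of a no-dip company is
wiggle-free when NO incoherent row is switched (bottom weight) and when ALL are (top weight, coherent rows unswitched); only windows
holding switched AND unswitched incoherent rows together (the «risers against pullers» regime of ✓ `…Riccati`) remain.
HONEST FRAMING: a phase cell of the research floor; NOT `OneChangeFloorK3` / `stub_eulerBoundK3` / `stub_classRowK3` / `stub_polyLaw` /
`MatrixDescartes`; `VP ≠ VNP` is NOT proved.  No definitions, no named facts; Mathlib + the lane files.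
-/

set_option linter.dupNamespace false

namespace Summit.ValiantsHypothesis.ValiantsHypothesis.Theorems.LacunarySymmetroidMatrixDescartes

namespace ProductPlusOne

open Polynomial Finset
open scoped BigOperators

/-! ### §1 The top-weight Riccati identity and the pointwise sign -/

/-- **Top-weight Riccati form** (no sign hypothesis): with `num` the numerator of `Ψ_g′` (✓ `hasDerivAt_term`) and `N = p b + q c x^{k+1}`,
`x^{k+1}·num − (k+1)·x^k·N·g(x) = −x^k·((k+1)(e+1)·b·g(x) + x^{e+1}·N²)`. [folklore] -/
theorem top_numerator_eq (a b c : ℝ) (e k : ℕ) (x : ℝ) :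
    x ^ (k + 1) * (((e + k + 2 : ℝ) * c * ((k + 1 : ℝ) * x ^ k)) * (a + b * x ^ (e + 1) + c * x ^ (e + k + 2))
        - ((e + 1 : ℝ) * b + (e + k + 2 : ℝ) * c * x ^ (k + 1))
          * (b * ((e + 1 : ℝ) * x ^ e) + c * ((e + k + 2 : ℝ) * x ^ (e + k + 1))))
      - ((k + 1 : ℝ) * x ^ k) * ((e + 1 : ℝ) * b + (e + k + 2 : ℝ) * c * x ^ (k + 1)) * (a + b * x ^ (e + 1) + c * x ^ (e + k + 2))
      = -(x ^ k * ((k + 1 : ℝ) * (e + 1 : ℝ) * (b * (a + b * x ^ (e + 1) + c * x ^ (e + k + 2)))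
          + x ^ (e + 1) * ((e + 1 : ℝ) * b + (e + k + 2 : ℝ) * c * x ^ (k + 1)) ^ 2)) := by
  ring

/-- **A factor ALONGSIDE ITS MIDDLE LETTER is `T`-decreasing, every ratio, every sign pattern** (`b·g(x) > 0`; or no middle letter,
`b = 0`, with `c ≠ 0`, `g(x) ≠ 0`): the derivative numerator `x^{k+1}·num − (k+1)x^k·N·g` is negative at `x > 0`. [this file's lemma] -/
theorem top_deriv_numerator_neg (a b c : ℝ) (e k : ℕ) {x : ℝ} (hx : 0 < x)
    (hrow : 0 < b * (a + b * x ^ (e + 1) + c * x ^ (e + k + 2)) ∨ (b = 0 ∧ c ≠ 0 ∧ a + b * x ^ (e + 1) + c * x ^ (e + k + 2) ≠ 0)) :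
    x ^ (k + 1) * (((e + k + 2 : ℝ) * c * ((k + 1 : ℝ) * x ^ k)) * (a + b * x ^ (e + 1) + c * x ^ (e + k + 2))
        - ((e + 1 : ℝ) * b + (e + k + 2 : ℝ) * c * x ^ (k + 1))
          * (b * ((e + 1 : ℝ) * x ^ e) + c * ((e + k + 2 : ℝ) * x ^ (e + k + 1))))
      - ((k + 1 : ℝ) * x ^ k) * ((e + 1 : ℝ) * b + (e + k + 2 : ℝ) * c * x ^ (k + 1)) * (a + b * x ^ (e + 1) + c * x ^ (e + k + 2))
      < 0 := by
  rw [top_numerator_eq]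
  have hxk : 0 < x ^ k := pow_pos hx k
  have hsq : 0 ≤ x ^ (e + 1) * ((e + 1 : ℝ) * b + (e + k + 2 : ℝ) * c * x ^ (k + 1)) ^ 2 := by positivity
  rcases hrow with h | ⟨hb, hc, hg⟩
  · have h1 : 0 < (k + 1 : ℝ) * (e + 1 : ℝ) * (b * (a + b * x ^ (e + 1) + c * x ^ (e + k + 2))) := by positivity
    have h2 : 0 < x ^ k * ((k + 1 : ℝ) * (e + 1 : ℝ) * (b * (a + b * x ^ (e + 1) + c * x ^ (e + k + 2)))
        + x ^ (e + 1) * ((e + 1 : ℝ) * b + (e + k + 2 : ℝ) * c * x ^ (k + 1)) ^ 2) := mul_pos hxk (by linarith)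
    linarith
  · subst hb
    have hN : (e + 1 : ℝ) * 0 + (e + k + 2 : ℝ) * c * x ^ (k + 1) ≠ 0 := by
      rw [mul_zero, zero_add]
      exact mul_ne_zero (mul_ne_zero (by positivity) hc) (pow_ne_zero _ hx.ne')
    have hsq' : 0 < x ^ (e + 1) * ((e + 1 : ℝ) * 0 + (e + k + 2 : ℝ) * c * x ^ (k + 1)) ^ 2 :=
      mul_pos (pow_pos hx _) (by positivity)
    have h2 : 0 < x ^ k * ((k + 1 : ℝ) * (e + 1 : ℝ) * (0 * (a + 0 * x ^ (e + 1) + c * x ^ (e + k + 2)))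
        + x ^ (e + 1) * ((e + 1 : ℝ) * 0 + (e + k + 2 : ℝ) * c * x ^ (k + 1)) ^ 2) := by
      rw [zero_mul, mul_zero, zero_add]
      exact mul_pos hxk hsq'
    linarith

/-! ### §2 The top-weighted sum `Σ_j Ψ_j / x^{k+1}`: derivative, monotonicity, Rolle -/

/-- `HasDerivAt` of one top-weighted summand `y ↦ Ψ_j(y) / y^{k+1}` off the zeros of the factor, `y ≠ 0`. [folklore] -/
theorem hasDerivAt_top_term (a b c : ℝ) (e k : ℕ) {x : ℝ} (hx : x ≠ 0) (hg : a + b * x ^ (e + 1) + c * x ^ (e + k + 2) ≠ 0) :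
    HasDerivAt (fun y : ℝ => (((e + 1 : ℝ) * b + (e + k + 2 : ℝ) * c * y ^ (k + 1))
        / (a + b * y ^ (e + 1) + c * y ^ (e + k + 2))) / y ^ (k + 1))
      (((((e + k + 2 : ℝ) * c * ((k + 1 : ℝ) * x ^ k)) * (a + b * x ^ (e + 1) + c * x ^ (e + k + 2))
          - ((e + 1 : ℝ) * b + (e + k + 2 : ℝ) * c * x ^ (k + 1))
            * (b * ((e + 1 : ℝ) * x ^ e) + c * ((e + k + 2 : ℝ) * x ^ (e + k + 1))))
          / (a + b * x ^ (e + 1) + c * x ^ (e + k + 2)) ^ 2 * x ^ (k + 1)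
        - ((e + 1 : ℝ) * b + (e + k + 2 : ℝ) * c * x ^ (k + 1)) / (a + b * x ^ (e + 1) + c * x ^ (e + k + 2))
          * ((k + 1 : ℕ) * x ^ k)) / (x ^ (k + 1)) ^ 2) x :=
  (hasDerivAt_term a b c e k hg).div (hasDerivAt_pow (k + 1) x) (pow_ne_zero _ hx)

/-- The value of that derivative is NEGATIVE under the middle-letter criterion (`x > 0`). [this file's lemma] -/
theorem top_term_deriv_neg (a b c : ℝ) (e k : ℕ) {x : ℝ} (hx : 0 < x) (hg : a + b * x ^ (e + 1) + c * x ^ (e + k + 2) ≠ 0)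
    (hrow : 0 < b * (a + b * x ^ (e + 1) + c * x ^ (e + k + 2)) ∨ (b = 0 ∧ c ≠ 0 ∧ a + b * x ^ (e + 1) + c * x ^ (e + k + 2) ≠ 0)) :
    ((((e + k + 2 : ℝ) * c * ((k + 1 : ℝ) * x ^ k)) * (a + b * x ^ (e + 1) + c * x ^ (e + k + 2))
          - ((e + 1 : ℝ) * b + (e + k + 2 : ℝ) * c * x ^ (k + 1))
            * (b * ((e + 1 : ℝ) * x ^ e) + c * ((e + k + 2 : ℝ) * x ^ (e + k + 1))))
          / (a + b * x ^ (e + 1) + c * x ^ (e + k + 2)) ^ 2 * x ^ (k + 1)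
        - ((e + 1 : ℝ) * b + (e + k + 2 : ℝ) * c * x ^ (k + 1)) / (a + b * x ^ (e + 1) + c * x ^ (e + k + 2))
          * ((k + 1 : ℕ) * x ^ k)) / (x ^ (k + 1)) ^ 2 < 0 := by
  have hg2 : 0 < (a + b * x ^ (e + 1) + c * x ^ (e + k + 2)) ^ 2 := by positivity
  have hden : 0 < (x ^ (k + 1)) ^ 2 := by positivity
  refine div_neg_of_neg_of_pos ?_ hden
  have hkey := top_deriv_numerator_neg a b c e k hx hrow
  -- clear the denominators `g²`
  have hid : (((e + k + 2 : ℝ) * c * ((k + 1 : ℝ) * x ^ k)) * (a + b * x ^ (e + 1) + c * x ^ (e + k + 2))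
          - ((e + 1 : ℝ) * b + (e + k + 2 : ℝ) * c * x ^ (k + 1))
            * (b * ((e + 1 : ℝ) * x ^ e) + c * ((e + k + 2 : ℝ) * x ^ (e + k + 1))))
          / (a + b * x ^ (e + 1) + c * x ^ (e + k + 2)) ^ 2 * x ^ (k + 1)
        - ((e + 1 : ℝ) * b + (e + k + 2 : ℝ) * c * x ^ (k + 1)) / (a + b * x ^ (e + 1) + c * x ^ (e + k + 2))
          * ((k + 1 : ℕ) * x ^ k)
      = (x ^ (k + 1) * (((e + k + 2 : ℝ) * c * ((k + 1 : ℝ) * x ^ k)) * (a + b * x ^ (e + 1) + c * x ^ (e + k + 2))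
          - ((e + 1 : ℝ) * b + (e + k + 2 : ℝ) * c * x ^ (k + 1))
            * (b * ((e + 1 : ℝ) * x ^ e) + c * ((e + k + 2 : ℝ) * x ^ (e + k + 1))))
        - ((k + 1 : ℝ) * x ^ k) * ((e + 1 : ℝ) * b + (e + k + 2 : ℝ) * c * x ^ (k + 1)) * (a + b * x ^ (e + 1) + c * x ^ (e + k + 2)))
        / (a + b * x ^ (e + 1) + c * x ^ (e + k + 2)) ^ 2 := by
    push_cast
    field_simp
  rw [hid]
  exact div_neg_of_neg_of_pos hkey hg2

/-- **`(Σ_j Ψ_j / y^{k+1})′ < 0`** under the middle-letter criterion (`m ≥ 1`, `x > 0`, no factor vanishing). [this file's theorem] -/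
theorem hasDerivAt_top_neg_of_rows {m : ℕ} (hm : 0 < m) (a b c : Fin m → ℝ) (e k : ℕ) {x : ℝ} (hx : 0 < x)
    (hg : ∀ j, a j + b j * x ^ (e + 1) + c j * x ^ (e + k + 2) ≠ 0)
    (hrow : ∀ j, 0 < b j * (a j + b j * x ^ (e + 1) + c j * x ^ (e + k + 2)) ∨
      (b j = 0 ∧ c j ≠ 0 ∧ a j + b j * x ^ (e + 1) + c j * x ^ (e + k + 2) ≠ 0)) :
    ∃ D : ℝ, D < 0 ∧ HasDerivAt (fun y : ℝ => ∑ j, (((e + 1 : ℝ) * b j + (e + k + 2 : ℝ) * c j * y ^ (k + 1))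
        / (a j + b j * y ^ (e + 1) + c j * y ^ (e + k + 2))) / y ^ (k + 1)) D x := by
  refine ⟨∑ j, (((((e + k + 2 : ℝ) * c j * ((k + 1 : ℝ) * x ^ k)) * (a j + b j * x ^ (e + 1) + c j * x ^ (e + k + 2))
          - ((e + 1 : ℝ) * b j + (e + k + 2 : ℝ) * c j * x ^ (k + 1))
            * (b j * ((e + 1 : ℝ) * x ^ e) + c j * ((e + k + 2 : ℝ) * x ^ (e + k + 1))))
          / (a j + b j * x ^ (e + 1) + c j * x ^ (e + k + 2)) ^ 2 * x ^ (k + 1)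
        - ((e + 1 : ℝ) * b j + (e + k + 2 : ℝ) * c j * x ^ (k + 1)) / (a j + b j * x ^ (e + 1) + c j * x ^ (e + k + 2))
          * ((k + 1 : ℕ) * x ^ k)) / (x ^ (k + 1)) ^ 2), ?_, ?_⟩
  · refine Finset.sum_neg (fun j _ => ?_) ⟨⟨0, hm⟩, Finset.mem_univ _⟩
    exact top_term_deriv_neg (a j) (b j) (c j) e k hx (hg j) (hrow j)
  · exact HasDerivAt.fun_sum (u := Finset.univ) (fun j _ => hasDerivAt_top_term (a j) (b j) (c j) e k hx.ne' (hg j))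

/-- **Rolle for the top-weighted sum:** on a window `[w₁,w₂] ⊂ (0,∞)` with no factor vanishing and the middle-letter criterion at every
point, `Σ_j Ψ_j / y^{k+1}` does not take the same value twice. [this file's lemma] -/
theorem top_injective_of_rows {m : ℕ} (hm : 0 < m) (a b c : Fin m → ℝ) (e k : ℕ) {w₁ w₂ : ℝ} (hw₁ : 0 < w₁) (hw : w₁ < w₂)
    (hfree : ∀ t ∈ Set.Icc w₁ w₂, ∀ j, a j + b j * t ^ (e + 1) + c j * t ^ (e + k + 2) ≠ 0)
    (hrow : ∀ t ∈ Set.Icc w₁ w₂, ∀ j, 0 < b j * (a j + b j * t ^ (e + 1) + c j * t ^ (e + k + 2)) ∨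
      (b j = 0 ∧ c j ≠ 0 ∧ a j + b j * t ^ (e + 1) + c j * t ^ (e + k + 2) ≠ 0))
    (heq : (∑ j, (((e + 1 : ℝ) * b j + (e + k + 2 : ℝ) * c j * w₁ ^ (k + 1))
        / (a j + b j * w₁ ^ (e + 1) + c j * w₁ ^ (e + k + 2))) / w₁ ^ (k + 1))
      = ∑ j, (((e + 1 : ℝ) * b j + (e + k + 2 : ℝ) * c j * w₂ ^ (k + 1))
        / (a j + b j * w₂ ^ (e + 1) + c j * w₂ ^ (e + k + 2))) / w₂ ^ (k + 1)) :
    False := by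
  have hcont : ContinuousOn (fun y : ℝ => ∑ j, (((e + 1 : ℝ) * b j + (e + k + 2 : ℝ) * c j * y ^ (k + 1))
      / (a j + b j * y ^ (e + 1) + c j * y ^ (e + k + 2))) / y ^ (k + 1)) (Set.Icc w₁ w₂) := by
    intro t ht
    obtain ⟨D, _, hD⟩ := hasDerivAt_top_neg_of_rows hm a b c e k (hw₁.trans_le ht.1) (hfree t ht) (hrow t ht)
    exact hD.continuousAt.continuousWithinAt
  obtain ⟨ξ, hξ, hξ'⟩ := exists_deriv_eq_zero hw hcont heq
  obtain ⟨D, hDneg, hD⟩ := hasDerivAt_top_neg_of_rows hm a b c e k (hw₁.trans hξ.1)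
    (hfree ξ ⟨hξ.1.le, hξ.2.le⟩) (hrow ξ ⟨hξ.1.le, hξ.2.le⟩)
  rw [hD.deriv] at hξ'
  exact hDneg.ne hξ'

/-! ### §3 The window law in the normalised chart and in the line's currency -/

/-- **THE SWITCHED-WINDOW LAW (normalised chart):** `X·P′` has no two zeros `w₁ < w₂` in `(0,∞)` with the middle-letter criterion holding
for every factor at every point of `[w₁,w₂]`. [this file's theorem] -/
theorem X_mul_derivative_no_two_zeros_of_middle {m : ℕ} (hm : 0 < m) (a b c : Fin m → ℝ) (e k : ℕ) {w₁ w₂ : ℝ}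
    (hw₁ : 0 < w₁) (hw : w₁ < w₂)
    (hrow : ∀ t ∈ Set.Icc w₁ w₂, ∀ j, 0 < b j * (a j + b j * t ^ (e + 1) + c j * t ^ (e + k + 2)) ∨
      (b j = 0 ∧ c j ≠ 0 ∧ a j + b j * t ^ (e + 1) + c j * t ^ (e + k + 2) ≠ 0))
    (h1 : eval w₁ (X * derivative (∏ j, (C (a j) + C (b j) * X ^ (e + 1) + C (c j) * X ^ (e + k + 2)))) = 0)
    (h2 : eval w₂ (X * derivative (∏ j, (C (a j) + C (b j) * X ^ (e + 1) + C (c j) * X ^ (e + k + 2)))) = 0) : False := by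
  have hfree : ∀ t ∈ Set.Icc w₁ w₂, ∀ j, a j + b j * t ^ (e + 1) + c j * t ^ (e + k + 2) ≠ 0 := by
    intro t ht j
    rcases hrow t ht j with h | ⟨_, _, h⟩
    · intro h0
      rw [h0, mul_zero] at h
      exact lt_irrefl 0 h
    · exact h
  have hz : ∀ w : ℝ, 0 < w → (∀ j, a j + b j * w ^ (e + 1) + c j * w ^ (e + k + 2) ≠ 0) →
      eval w (X * derivative (∏ j, (C (a j) + C (b j) * X ^ (e + 1) + C (c j) * X ^ (e + k + 2)))) = 0 →
      (∑ j, (((e + 1 : ℝ) * b j + (e + k + 2 : ℝ) * c j * w ^ (k + 1))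
        / (a j + b j * w ^ (e + 1) + c j * w ^ (e + k + 2))) / w ^ (k + 1)) = 0 := by
    intro w hw0 hgw h0
    rw [← Finset.sum_div, psi_eq_zero_of_eval_X_mul_derivative a b c e k hw0 hgw h0, zero_div]
  exact top_injective_of_rows hm a b c e k hw₁ hw hfree hrow
    ((hz w₁ hw₁ (hfree w₁ ⟨le_rfl, hw.le⟩) h1).trans (hz w₂ (hw₁.trans hw) (hfree w₂ ⟨hw.le, le_rfl⟩) h2).symm)

/-- ★ **THE SWITCHED-WINDOW LAW** (`K = 3`, bottom coupling, ANY support `d 0 < d 1 < d 2`, any `m`).  On a window `[u,v] ⊂ (0,∞)` on which,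
at every point `t`, every row `f_j = Σ_l a_{jl} X^{d_l}` is ALONGSIDE ITS MIDDLE LETTER (`a_{j1}·f_j(t) > 0`: a one-signed row, an
unswitched coherent row, a SWITCHED incoherent row, a dip row inside its dip) or has no middle letter (`a_{j1} = 0`, `a_{j2} ≠ 0`,
`f_j(t) ≠ 0`), the c-free Euler numerator `eulerNumerator d a 0` has AT MOST ONE root. [this file's theorem] -/
theorem euler_window_roots_le_one_of_middle {m : ℕ} (d : Fin 3 → ℕ) (h01 : d 0 < d 1) (h12 : d 1 < d 2)
    (a : Fin m → Fin 3 → ℝ) {u v : ℝ} (hu : 0 < u)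
    (hrow : ∀ t ∈ Set.Icc u v, ∀ j,
      0 < a j 1 * (∑ l, C (a j l) * X ^ (d l) : ℝ[X]).eval t ∨
      (a j 1 = 0 ∧ a j 2 ≠ 0 ∧ (∑ l, C (a j l) * X ^ (d l) : ℝ[X]).eval t ≠ 0)) :
    ((∑ j, (∑ l, C (a j l * ((d l : ℝ) - d 0)) * X ^ (d l)) * ∏ i ∈ Finset.univ.erase j, (∑ l, C (a i l) * X ^ (d l))
        : ℝ[X]).roots.toFinset.filter (fun t => u ≤ t ∧ t ≤ v)).card ≤ 1 := by
  classical
  rcases Nat.eq_zero_or_pos m with hm | hm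
  · subst hm
    simp only [Finset.univ_eq_empty, Finset.sum_empty, roots_zero, Multiset.toFinset_zero, Finset.filter_empty,
      Finset.card_empty]
    exact Nat.zero_le _
  obtain ⟨e, he⟩ : ∃ e, d 1 = d 0 + e + 1 := ⟨d 1 - d 0 - 1, by omega⟩
  obtain ⟨k, hk⟩ : ∃ k, d 2 = d 0 + e + k + 2 := ⟨d 2 - d 1 - 1, by omega⟩
  rw [eulerNumerator_eq d e k he hk a 0, sub_self, mul_zero, map_zero, zero_mul, sub_zero]
  set E : ℝ[X] := X * derivative (∏ j, (C (a j 0) + C (a j 1) * X ^ (e + 1) + C (a j 2) * X ^ (e + k + 2))) with hE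
  by_contra hgt
  push Not at hgt
  obtain ⟨z₁, hz₁, z₂, hz₂, hne⟩ := Finset.one_lt_card.mp hgt
  -- the row criterion in the normalised chart
  have hrow' : ∀ w₁ w₂ : ℝ, u ≤ w₁ → w₂ ≤ v → ∀ t ∈ Set.Icc w₁ w₂, ∀ j,
      0 < a j 1 * (a j 0 + a j 1 * t ^ (e + 1) + a j 2 * t ^ (e + k + 2)) ∨
      (a j 1 = 0 ∧ a j 2 ≠ 0 ∧ a j 0 + a j 1 * t ^ (e + 1) + a j 2 * t ^ (e + k + 2) ≠ 0) := by
    intro w₁ w₂ hw₁ hw₂ t ht j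
    have htI : t ∈ Set.Icc u v := ⟨hw₁.trans ht.1, ht.2.trans hw₂⟩
    have ht0 : 0 < t := hu.trans_le htI.1
    have htd : 0 < t ^ (d 0) := pow_pos ht0 _
    rcases hrow t htI j with h | ⟨hb, hc, hne0⟩
    · left
      rw [eval_row_eq_pow_mul d e k he hk (a j) t, mul_left_comm] at h
      exact pos_of_mul_pos_right h htd.le
    · right
      rw [eval_row_eq_pow_mul d e k he hk (a j) t] at hne0
      exact ⟨hb, hc, right_ne_zero_of_mul hne0⟩
  have hmem : ∀ z ∈ (((X : ℝ[X]) ^ (m * d 0) * E).roots.toFinset.filter (fun t => u ≤ t ∧ t ≤ v)),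
      u ≤ z ∧ z ≤ v ∧ eval z E = 0 := by
    intro z hz
    rw [mem_filter, Multiset.mem_toFinset] at hz
    by_cases h0 : (X : ℝ[X]) ^ (m * d 0) * E = 0
    · rw [h0, roots_zero] at hz
      exact absurd hz.1 (Multiset.notMem_zero _)
    · have hr := (mem_roots h0).mp hz.1
      rw [IsRoot.def, eval_mul, eval_pow, eval_X] at hr
      refine ⟨hz.2.1, hz.2.2, ?_⟩
      rcases mul_eq_zero.mp hr with h | h
      · exact absurd h (pow_ne_zero _ (hu.trans_le hz.2.1).ne')
      · exact h
  obtain ⟨hu₁, hv₁, hE₁⟩ := hmem z₁ hz₁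
  obtain ⟨hu₂, hv₂, hE₂⟩ := hmem z₂ hz₂
  rcases lt_or_gt_of_ne hne with hlt | hlt
  · exact X_mul_derivative_no_two_zeros_of_middle hm (fun j => a j 0) (fun j => a j 1) (fun j => a j 2) e k
      (hu.trans_le hu₁) hlt (hrow' z₁ z₂ hu₁ hv₂) hE₁ hE₂
  · exact X_mul_derivative_no_two_zeros_of_middle hm (fun j => a j 0) (fun j => a j 1) (fun j => a j 2) e k
      (hu.trans_le hu₂) hlt (hrow' z₂ z₁ hu₂ hv₁) hE₂ hE₁

/-! ### §4 Propagation and the LATE LAW for no-dip + one-signed companies -/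

/-- **Propagation upward.** If the top letter does not oppose the middle one (`b c ≥ 0`; incoherent no-dip rows `(+,−,−)`, one-signed rows
with `b c ≥ 0`), then `b·g(t) = ab + b²·t^p + bc·t^q` is non-decreasing in `t > 0`: «alongside its middle letter at `u`» (for an incoherent
no-dip row: SWITCHED at `u`) holds on all of `[u, ∞)`. [folklore] -/
theorem middle_aligned_of_le (a b c : ℝ) (e k : ℕ) (hbc : 0 ≤ b * c) {u t : ℝ} (hu : 0 < u) (hut : u ≤ t)
    (hua : 0 < b * (a + b * u ^ (e + 1) + c * u ^ (e + k + 2))) :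
    0 < b * (a + b * t ^ (e + 1) + c * t ^ (e + k + 2)) := by
  have h1 : b * b * u ^ (e + 1) ≤ b * b * t ^ (e + 1) :=
    mul_le_mul_of_nonneg_left (pow_le_pow_left₀ hu.le hut _) (mul_self_nonneg b)
  have h2 : b * c * u ^ (e + k + 2) ≤ b * c * t ^ (e + k + 2) :=
    mul_le_mul_of_nonneg_left (pow_le_pow_left₀ hu.le hut _) hbc
  have e1 : b * (a + b * t ^ (e + 1) + c * t ^ (e + k + 2)) = b * a + b * b * t ^ (e + 1) + b * c * t ^ (e + k + 2) := by ring
  have e2 : b * (a + b * u ^ (e + 1) + c * u ^ (e + k + 2)) = b * a + b * b * u ^ (e + 1) + b * c * u ^ (e + k + 2) := by ring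
  rw [e1]
  rw [e2] at hua
  linarith

/-- ★ **LATE LAW (every support ratio).**  A company whose rows are no-dip (`a_{j0} a_{j2} < 0`) or one-signed with a middle letter
(`a_{j0} a_{j1} > 0`, `a_{j1} a_{j2} ≥ 0`), bottom coupling, ANY `d 0 < d 1 < d 2`, window `[u,v] ⊂ (0,∞)`: if every INCOHERENT no-dip row
(`a_{j0} a_{j1} < 0`) is already SWITCHED at `u` (`a_{j1}·f_j(u) > 0`), every no-dip row without middle letter (`a_{j1} = 0`) does not vanish
on the window, and every COHERENT no-dip row (`a_{j0} a_{j1} > 0 > a_{j0} a_{j2}`) is alongside its middle letter on the window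
(`a_{j1}·f_j(t) > 0`, i.e. unswitched), then `eulerNumerator d a 0` has at most ONE root in `[u,v]`. [this file's theorem] -/
theorem euler_roots_window_le_one_lateNoDip {m : ℕ} (d : Fin 3 → ℕ) (h01 : d 0 < d 1) (h12 : d 1 < d 2)
    (a : Fin m → Fin 3 → ℝ) {u v : ℝ} (hu : 0 < u)
    (hcls : ∀ j, a j 0 * a j 2 < 0 ∨ (0 < a j 0 * a j 1 ∧ 0 ≤ a j 1 * a j 2))
    (hinc : ∀ j, a j 0 * a j 1 < 0 → 0 < a j 1 * (∑ l, C (a j l) * X ^ (d l) : ℝ[X]).eval u)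
    (hnomid : ∀ j, a j 1 = 0 → ∀ t ∈ Set.Icc u v, (∑ l, C (a j l) * X ^ (d l) : ℝ[X]).eval t ≠ 0)
    (hcoh : ∀ j, 0 < a j 0 * a j 1 → a j 0 * a j 2 < 0 → ∀ t ∈ Set.Icc u v,
      0 < a j 1 * (∑ l, C (a j l) * X ^ (d l) : ℝ[X]).eval t) :
    ((∑ j, (∑ l, C (a j l * ((d l : ℝ) - d 0)) * X ^ (d l)) * ∏ i ∈ Finset.univ.erase j, (∑ l, C (a i l) * X ^ (d l))
        : ℝ[X]).roots.toFinset.filter (fun t => u ≤ t ∧ t ≤ v)).card ≤ 1 := by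
  obtain ⟨e, he⟩ : ∃ e, d 1 = d 0 + e + 1 := ⟨d 1 - d 0 - 1, by omega⟩
  obtain ⟨k, hk⟩ : ∃ k, d 2 = d 0 + e + k + 2 := ⟨d 2 - d 1 - 1, by omega⟩
  refine euler_window_roots_le_one_of_middle d h01 h12 a hu (fun t ht j => ?_)
  have ht0 : 0 < t := hu.trans_le ht.1
  have htd : 0 < t ^ (d 0) := pow_pos ht0 _
  rcases lt_trichotomy (a j 0 * a j 1) 0 with hab | hab | hab
  · -- incoherent no-dip row, switched at `u`, hence at `t ≥ u`
    left
    have hac : a j 0 * a j 2 < 0 := by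
      rcases hcls j with h | ⟨h, _⟩
      · exact h
      · linarith
    have h12' : 0 ≤ a j 1 * a j 2 := by
      have h1 : 0 < (a j 0 * a j 1) * (a j 0 * a j 2) := mul_pos_of_neg_of_neg hab hac
      by_contra hneg
      push Not at hneg
      have h2 : (a j 0 * a j 1) * (a j 0 * a j 2) = a j 0 ^ 2 * (a j 1 * a j 2) := by ring
      rw [h2] at h1
      have h3 : a j 0 ^ 2 * (a j 1 * a j 2) ≤ 0 := mul_nonpos_of_nonneg_of_nonpos (sq_nonneg _) hneg.le
      linarith
    have hgu : 0 < a j 1 * (a j 0 + a j 1 * u ^ (e + 1) + a j 2 * u ^ (e + k + 2)) := by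
      have h := hinc j hab
      rw [eval_row_eq_pow_mul d e k he hk (a j) u, mul_left_comm] at h
      exact pos_of_mul_pos_right h (pow_pos hu _).le
    have hgt := middle_aligned_of_le (a j 0) (a j 1) (a j 2) e k h12' hu ht.1 hgu
    rw [eval_row_eq_pow_mul d e k he hk (a j) t, mul_left_comm]
    exact mul_pos htd hgt
  · -- no middle letter: `a_{j1} = 0` (then the row is no-dip by `hcls`)
    right
    have ha0 : a j 0 ≠ 0 := by
      intro h0
      rcases hcls j with h | ⟨h, _⟩
      · rw [h0, zero_mul] at h; exact lt_irrefl 0 h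
      · rw [h0, zero_mul] at h; exact lt_irrefl 0 h
    have hb : a j 1 = 0 := by
      rcases mul_eq_zero.mp hab with h | h
      · exact absurd h ha0
      · exact h
    have hc : a j 2 ≠ 0 := by
      intro h0
      rcases hcls j with h | ⟨h, _⟩
      · rw [h0, mul_zero] at h; exact lt_irrefl 0 h
      · rw [hb, mul_zero] at h; exact lt_irrefl 0 h
    exact ⟨hb, hc, hnomid j hb t ht⟩
  · -- middle letter on the side of the bottom one: coherent no-dip (hypothesis `hcoh`) or one-signed (automatic)
    left
    rcases hcls j with hac | ⟨_, hbc⟩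
    · exact hcoh j hab hac t ht
    · -- one-signed row with `b c ≥ 0`: `b·g(t) = ab + b² t^p + bc t^q > 0`
      rw [eval_row_eq_pow_mul d e k he hk (a j) t, mul_left_comm]
      refine mul_pos htd ?_
      have e1 : a j 1 * (a j 0 + a j 1 * t ^ (e + 1) + a j 2 * t ^ (e + k + 2))
          = a j 0 * a j 1 + a j 1 * a j 1 * t ^ (e + 1) + a j 1 * a j 2 * t ^ (e + k + 2) := by ring
      rw [e1]
      have h1 : 0 ≤ a j 1 * a j 1 * t ^ (e + 1) := mul_nonneg (mul_self_nonneg _) (pow_pos ht0 _).le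
      have h2 : 0 ≤ a j 1 * a j 2 * t ^ (e + k + 2) := mul_nonneg hbc (pow_pos ht0 _).le
      linarith

end ProductPlusOne

end Summit.ValiantsHypothesis.ValiantsHypothesis.Theorems.LacunarySymmetroidMatrixDescartes
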